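import Literature.NumberTheory.LFunctions.WeilTwoPrimePos59Def
import Literature.NumberTheory.LFunctions.WeilTwoPrimePos59DataPme6
import Literature.NumberTheory.LFunctions.WeilBlockRowsPZ
import HarnessLib

/-!
# Two-prime positivity certificate (a₀ = 59/100): Bessel block claim `C H Cᵀ`, block 0, rows 10–14

Kernel facts by `decide +kernel`, one declaration per row. Pure proof file.
-/

noncomputable section

namespace Literature.NumberTheory.LFunctions

set_option maxHeartbeats 0 in
/-- Bessel block claim `C H Cᵀ`, block 0, row 10 (positivity certificate). [folklore] -/
theorem checkHpRow0_10_weilCert23P : weilCert23PBase.checkHpRow weilCert23PHpe 0 10 = true := by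
  decide +kernel

set_option maxHeartbeats 0 in
/-- Bessel block claim `C H Cᵀ`, block 0, row 11 (positivity certificate). [folklore] -/
theorem checkHpRow0_11_weilCert23P : weilCert23PBase.checkHpRow weilCert23PHpe 0 11 = true := by
  decide +kernel

set_option maxHeartbeats 0 in
/-- Bessel block claim `C H Cᵀ`, block 0, row 12 (positivity certificate). [folklore] -/
theorem checkHpRow0_12_weilCert23P : weilCert23PBase.checkHpRow weilCert23PHpe 0 12 = true := by
  decide +kernel

set_option maxHeartbeats 0 in
/-- Bessel block claim `C H Cᵀ`, block 0, row 13 (positivity certificate). [folklore] -/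
theorem checkHpRow0_13_weilCert23P : weilCert23PBase.checkHpRow weilCert23PHpe 0 13 = true := by
  decide +kernel

set_option maxHeartbeats 0 in
/-- Bessel block claim `C H Cᵀ`, block 0, row 14 (positivity certificate). [folklore] -/
theorem checkHpRow0_14_weilCert23P : weilCert23PBase.checkHpRow weilCert23PHpe 0 14 = true := by
  decide +kernel


end Literature.NumberTheory.LFunctions
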